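import Summits.ResolutionOfSingularities.ResolutionOfSingularities.Theorems.EquisingularLiftEquisingularLiftNatNDModelStepFrame
import Literature.AlgebraicGeometry.Resolution.StrictTransformBaseChange
import HarnessLib

/-!
# [OURS · L1 W4.5(b) · EL♮(3)] (B4α1s) THE UNTOUCHED CHART — `…NatNDModelStepUntouchedChart`: the (TS1) chart clause of `ModelStep` at an OLD chart whose cone
# does not contain the starred face (support for res-L1-w45b-stub-4's `modelStep`; desk APPROVAL 2026-08-28T14:58:32Z of iso-w1 support under the (B4α1s) row)

OURS · L1 W4.5(b) · EL♮(3) stmt-ResolutionOfSingularities-20148 (parent EL♮ stmt-…-20038) · counted 0 · AI-written (res-L1-w45b-iso-w1 g0, WIDTH seat on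
D-0157 DOOR 1), weaker than expert review; nothing of [Hironaka2017] asserted; no statement of the manuscript; dim-3 char-p resolution is CP 2008/2009 in
print — this is a piece of OUR kernel-own version.  Sorry-free, def-free, standard axioms, no instance, no notation.  Every field `k`, every `n`, a
GENERAL base map `φ : F ⟶ Aff n k` (no `ToricStage`).  `--supports stmt-ResolutionOfSingularities-20148 --as helper`: support toward the registered 4th
CHILD stub `stub_elnat_three_isolated_newtonNondegenerate` through (B4α1s) `modelStep` (stub-4 assembles BY NAME; one writer per brick).

WHAT IS PROVED:
* `strictTransformIdeal_centre_top` — with EMPTY centre the strict transform is the total transform; `comap_eq_top_of_le`.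
* `untouchedChart` — one star at `τ` (centre `C = stratum E τ`, ANY blow-up `υ` of it) seen from an old chart `(σ, B, c)` with `τ ⊄ σ` and the created
  ray `Στ ∉ σ` (freshness): `C|_{range c} = ⊤`, so `υ` is an isomorphism over `range c` (`IsBlowup.isIso_morphismRestrict`) and `c` LIFTS to an open
  immersion `c' : 𝔸ⁿ_k ⟶ F'`, `c' ≫ υ = c`, `range c' = υ⁻¹(range c)`; and the four (TS1) sub-clauses of the NEW stage hold on `c'` with the SAME cone and
  matrix — same chart map `ψ` (meant: `toricChartHom n k B`), members of `E.stepAlong C (Στ) υ` at the rays of `σ` = coordinate hyperplanes (strict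
  transform = total transform where the centre is absent: `comap_strictTransformIdeal_le` along `c' ≫ υ = 𝟙 ≫ c` + the reverse inclusion from the total
  transform), other members (incl. the exceptional one) absent, `c'⁻¹ closure (υ⁻¹(T ∖ supp C)) = V(toricStrict B g)` (open maps: preimage of a closure is
  the closure of the preimage).  In `modelStep`'s assembly this is the branch `¬ τ ⊆ σ` of the case split on the old chart at `υ x'`; the branch `τ ⊆ σ`
  (the genuinely toric one: `𝓘Λ`, `starChart`, `AffineCoordBlowup.chartImm`) is stub-4's.
-/

set_option linter.dupNamespace false

noncomputable section

open CategoryTheory CategoryTheory.Limits AlgebraicGeometry TopologicalSpace Topology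
open MvPolynomial
open Literature.AlgebraicGeometry.Resolution
open AlgebraicGeometry.Scheme.IdealSheafData

namespace Summit.ResolutionOfSingularities.ResolutionOfSingularities.Cruxes.EquisingularLiftNat.Sections.ND

open Summit.ResolutionOfSingularities.ResolutionOfSingularities.Cruxes.EquisingularLiftNat.Sections

section Untouched

variable {n : ℕ} {k : Type} [Field k]

/-- The strict transform with EMPTY centre (`C = ⊤`) is the total transform. [OURS · folklore] -/
theorem strictTransformIdeal_centre_top {X X' : Scheme.{0}} (π : X' ⟶ X) (K : X.IdealSheafData) :
    strictTransformIdeal π ⊤ K = K.comap π := by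
  apply le_antisymm
  · rw [strictTransformIdeal]
    refine iSup_le fun m => ?_
    rw [Scheme.IdealSheafData.comap_top, ← Scheme.IdealSheafData.one_eq_top, one_pow, Scheme.IdealSheafData.one_eq_top, colon_top]
  · exact comap_le_strictTransformIdeal π ⊤ K

/-- A member absent on a chart makes every larger ideal sheaf absent there: `K ≤ C`, `K.comap c = ⊤` ⟹ `C.comap c = ⊤`. [OURS] -/
theorem comap_eq_top_of_le {X Y : Scheme.{0}} (c : Y ⟶ X) {K C : X.IdealSheafData} (hKC : K ≤ C) (hK : K.comap c = ⊤) :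
    C.comap c = ⊤ :=
  top_le_iff.mp (hK ▸ (map_gc c).monotone_l hKC)

/-- **(B4α1s) THE UNTOUCHED CHART.**  One star at the face `τ` (centre `C = stratum E τ`, blow-up `υ`), seen from an OLD toric chart `(σ, B, c)` whose cone
does NOT contain `τ` and does not contain the created ray `Στ` (freshness): the centre is absent on the chart (`C|_{U_B} = ⊤`, as some member `E ρ`,
`ρ ∈ τ ∖ σ`, is), so `υ` is an isomorphism over `U_B = range c` and `c` LIFTS to an open immersion `c' : 𝔸ⁿ_k ⟶ F'` with `c' ≫ υ = c` and
`range c' = υ⁻¹(range c)`; on it the (TS1) clauses of the NEW stage hold with the SAME cone and matrix: same chart map to `𝔸ⁿ_k`, the stepped boundary's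
members at the rays of `σ` are the coordinate hyperplanes (strict transform = total transform where the centre is absent:
`comap_strictTransformIdeal_of_flat` along the square `c' ≫ υ = 𝟙 ≫ c`), the other members — including the new exceptional one — are absent, and the
strict transform of `T` pulls back to `V(toricStrict B g)` (open maps commute `closure` with preimages).  General base map `φ`; no `ToricStage`.
[OURS · L1 W4.5b · support for res-L1-w45b-stub-4's `modelStep`] -/
theorem untouchedChart {F F' : Scheme.{0}} (g : MvPolynomial (Fin n) k) (φ : F ⟶ Aff n k) (E : Boundary n F) (T : Set F)
    (hT : IsClosed T) (τ : Finset (Ray n)) (υ : F' ⟶ F) (hυ : IsBlowup υ (stratum E τ))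
    (σ : Finset (Ray n)) (B : Fin n → Fin n → ℕ) (c : Aff n k ⟶ F) [IsOpenImmersion c]
    (hσB : σ = Finset.univ.image (fun i => rayOf (B i)))
    (ψ : MvPolynomial (Fin n) k →+* MvPolynomial (Fin n) k) (hcφ : c ≫ φ = Spec.map (CommRingCat.ofHom ψ))
    (hEc : ∀ i, (E (rayOf (B i))).comap c = coordHyperplane n k i)
    (hEtop : ∀ ρ, ρ ∉ σ → (E ρ).comap c = ⊤)
    (hcT : c ⁻¹' T = PrimeSpectrum.zeroLocus {toricStrict B g})
    (hτσ : ¬ τ ⊆ σ) (hfresh : (∑ ρ ∈ τ, ρ) ∉ σ) :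
    ∃ c' : Aff n k ⟶ F', IsOpenImmersion c' ∧ c' ≫ υ = c ∧ Set.range c'.base = υ ⁻¹' Set.range c.base ∧
      c' ≫ (υ ≫ φ) = Spec.map (CommRingCat.ofHom ψ) ∧
      (∀ i, ((E.stepAlong (stratum E τ) (∑ ρ ∈ τ, ρ) υ) (rayOf (B i))).comap c' = coordHyperplane n k i) ∧
      (∀ ρ, ρ ∉ σ → ((E.stepAlong (stratum E τ) (∑ ρ ∈ τ, ρ) υ) ρ).comap c' = ⊤) ∧
      c' ⁻¹' closure (υ ⁻¹' (T \ ((stratum E τ).support : Set F))) = PrimeSpectrum.zeroLocus {toricStrict B g} := by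
  classical
  set C : F.IdealSheafData := stratum E τ with hCdef
  -- the centre is absent on the chart
  obtain ⟨ρ₀, hρ₀τ, hρ₀σ⟩ := Finset.not_subset.mp hτσ
  have hCc : C.comap c = ⊤ := comap_eq_top_of_le c (Finset.le_sup (f := E) hρ₀τ) (hEtop ρ₀ hρ₀σ)
  have hsuppC : c ⁻¹' (C.support : Set F) = ∅ := by
    have h := Scheme.IdealSheafData.support_comap C c
    rw [hCc, Scheme.IdealSheafData.support_top] at h
    have h' := congrArg (fun Z : Closeds (Aff n k) => (Z : Set (Aff n k))) h
    simp only [Closeds.coe_bot, Closeds.coe_preimage] at h'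
    exact h'.symm
  -- `υ` is an isomorphism over `U = range c`
  set U : F.Opens := c.opensRange with hUdef
  have hdisj : Disjoint (U : Set F) (C.support : Set F) := by
    rw [Set.disjoint_left]
    rintro x ⟨y, rfl⟩ hxC
    have : y ∈ c ⁻¹' (C.support : Set F) := hxC
    rw [hsuppC] at this
    exact this
  haveI hiso : IsIso (υ ∣_ U) := hυ.isIso_morphismRestrict hdisj
  -- the lifted chart
  let c' : Aff n k ⟶ F' := c.isoOpensRange.hom ≫ inv (υ ∣_ U) ≫ (υ ⁻¹ᵁ U).ι
  have hc'υ : c' ≫ υ = c := by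
    simp only [c', Category.assoc]
    rw [← morphismRestrict_ι, IsIso.inv_hom_id_assoc, Scheme.Hom.isoOpensRange_hom_ι]
  haveI hc'open : IsOpenImmersion c' := by
    simp only [c']
    infer_instance
  have hrange : Set.range c'.base = υ ⁻¹' Set.range c.base := by
    have hsurj : Function.Surjective ⇑(c.isoOpensRange.hom ≫ inv (υ ∣_ U)) :=
      (Scheme.Hom.homeomorph (c.isoOpensRange.hom ≫ inv (υ ∣_ U))).surjective
    have h1 : Set.range c'.base = Set.range (υ ⁻¹ᵁ U).ι.base := by
      apply le_antisymm
      · rintro _ ⟨a, rfl⟩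
        exact ⟨(c.isoOpensRange.hom ≫ inv (υ ∣_ U)) a, by simp only [c', Scheme.Hom.comp_apply]⟩
      · rintro _ ⟨z, rfl⟩
        obtain ⟨a, ha⟩ := hsurj z
        refine ⟨a, ?_⟩
        simp only [c', Scheme.Hom.comp_apply]
        rw [Scheme.Hom.comp_apply] at ha
        rw [ha]
    rw [h1, Scheme.Opens.range_ι]
    simp only [U, Scheme.Hom.coe_opensRange, TopologicalSpace.Opens.map_coe]
  -- the flat square `c' ≫ υ = 𝟙 ≫ c`
  have hsq : c' ≫ υ = 𝟙 (Aff n k) ≫ c := by rw [hc'υ, Category.id_comp]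
  have hst : ∀ K : F.IdealSheafData, (strictTransformIdeal υ C K).comap c' = K.comap c := fun K => by
    apply le_antisymm
    · refine (comap_strictTransformIdeal_le c hsq C K).trans (le_of_eq ?_)
      rw [hCc, strictTransformIdeal_centre_top, Scheme.IdealSheafData.comap_id]
    · calc K.comap c = (K.comap υ).comap c' := by rw [← Scheme.IdealSheafData.comap_comp, hc'υ]
        _ ≤ (strictTransformIdeal υ C K).comap c' :=
          (map_gc c').monotone_l ((comap_le_controlledTransform υ C K 1).trans (controlledTransform_le_strictTransformIdeal υ C K 1))
  refine ⟨c', hc'open, hc'υ, hrange, ?_, ?_, ?_, ?_⟩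
  · rw [← Category.assoc, hc'υ, hcφ]
  · intro i
    have hne : rayOf (B i) ≠ ∑ ρ ∈ τ, ρ := by
      intro h
      apply hfresh
      rw [← h, hσB]
      exact Finset.mem_image_of_mem _ (Finset.mem_univ i)
    rw [stepAlong_of_ne E C hne υ, hst, hEc i]
  · intro ρ hρ
    by_cases hν : ρ = ∑ ρ ∈ τ, ρ
    · rw [hν, stepAlong_self, ← Scheme.IdealSheafData.comap_comp, hc'υ, hCc]
    · rw [stepAlong_of_ne E C hν υ, hst, hEtop ρ hρ]
  · have hopen : IsOpenMap c'.base := c'.isOpenEmbedding.isOpenMap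
    rw [hopen.preimage_closure_eq_closure_preimage c'.continuous]
    have hpre : c' ⁻¹' (υ ⁻¹' (T \ (C.support : Set F))) = c ⁻¹' T := by
      rw [← hc'υ]
      ext a
      simp only [Set.mem_preimage, Scheme.Hom.comp_apply, Set.mem_sdiff]
      constructor
      · exact fun h => h.1
      · intro h
        refine ⟨h, fun hC => ?_⟩
        have : a ∈ c ⁻¹' (C.support : Set F) := by
          rw [← hc'υ]; simpa only [Set.mem_preimage, Scheme.Hom.comp_apply] using hC
        rw [hsuppC] at this
        exact this
    rw [hpre, (hT.preimage c.continuous).closure_eq, hcT]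

end Untouched

end Summit.ResolutionOfSingularities.ResolutionOfSingularities.Cruxes.EquisingularLiftNat.Sections.ND

end
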